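import Literature.Probability.Percolation.SelfRefinementMeasure
import Literature.Probability.Percolation.KohlerSchindlerTassionRSW

/-!
# Stub `stub_cone3` of line `finite-size-envelope` (crux `CriticalPathRSW`), part 3:
local coordinates of a tuple of `M_3` and the coins read by the opening rule

Support file for item `stmt-CriticalPhenomena-10267` (stub `stub_cone3`).  Fix a tuple of the
self-refinement model with `k = 3`: a coarse base `b : ℤ²` and a direction `d` (with `d'` the
other direction).  Its four vertices and the nearby lattice points are written in the local frame
`pt⟪α, β⟫ = 3b + α e_d + β e_{d'}` (a local notation, not a definition); its three sub-edges are the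
labels `(pt⟪j, 0⟫, d)`, `j = 0, 1, 2`, its coins are the selector `(b, d, 2)`, the shared coin
`(b, d, 1)` and the three own coins `(pt⟪j, 0⟫, d, 0)`.  Proved here:

* frame arithmetic: coordinates, injectivity, the unit steps `pt⟪α, β⟫ + e_d = pt⟪α + 1, β⟫`,
  axiality of the labels based at `pt⟪α, β⟫` (`3 ∣ β`, resp. `3 ∣ α`), `tupleBase` of the sub-edges,
  and the converse: an axial label of direction `d` with coarse base `b` IS a sub-edge
  (`Cone3.eq_pt_of_axial`);
* **the coins read by the opening rule** (`Cone3.refinementOpen_congr_off`): a label which is not a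
  sub-edge of the tuple and not in a given set `Λ` of labels keeps its state when the coins of the
  tuple and the own coins of `Λ` are modified — the locality input of every surgery below;
* the opening rule of the sub-edges and of non-axial labels under such modifications.

References: Beffara 2008 §5.1 (the model); Grimmett 1999 §2.2 (cylinder events).
-/

noncomputable section

namespace Summit.CriticalPhenomena.CardyFormulaZ2.Cruxes.CriticalPathRSW.FiniteSizeEnvelope

open Set
open Literature.Probability.LatticeModels Literature.Probability.Percolation

namespace Cone3

variable {b : Site 2} {d d' : Fin 2}

set_option quotPrecheck false

/-- The local frame of the tuple `(b, d)`: `pt⟪α, β⟫ = 3b + α e_d + β e_{d'}`. -/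
local notation "pt⟪" α ", " β "⟫" =>
  ((3 : ℤ) • b + (α : ℤ) • (Pi.single d (1 : ℤ) : Site 2) + (β : ℤ) • (Pi.single d' (1 : ℤ) : Site 2))

/-! ### The two directions -/

/-- In `Fin 2`, two distinct directions are `(0, 1)` or `(1, 0)`. -/
theorem fin2_cases (hd : d' ≠ d) : (d = 0 ∧ d' = 1) ∨ (d = 1 ∧ d' = 0) := by
  fin_cases d <;> fin_cases d' <;> simp_all

/-- Every index of `Fin 2` is one of two distinct directions. -/
theorem fin2_eq_or (hd : d' ≠ d) (i : Fin 2) : i = d ∨ i = d' := by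
  rcases fin2_cases hd with ⟨rfl, rfl⟩ | ⟨rfl, rfl⟩ <;> fin_cases i <;> simp

/-- The index orthogonal to `d` (as used by `IsAxialEdge`) is `d'`. -/
theorem other_eq (hd : d' ≠ d) : (if d = 0 then (1 : Fin 2) else 0) = d' := by
  rcases fin2_cases hd with ⟨rfl, rfl⟩ | ⟨rfl, rfl⟩ <;> simp

/-- The index orthogonal to `d'` is `d`. -/
theorem other_eq' (hd : d' ≠ d) : (if d' = 0 then (1 : Fin 2) else 0) = d := by
  rcases fin2_cases hd with ⟨rfl, rfl⟩ | ⟨rfl, rfl⟩ <;> simp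

/-! ### Frame arithmetic -/

/-- The `d`-coordinate of `pt⟪α, β⟫`. -/
theorem pt_apply_d (hd : d' ≠ d) (α β : ℤ) : (pt⟪α, β⟫) d = 3 * b d + α := by
  simp [hd.symm]

/-- The `d'`-coordinate of `pt⟪α, β⟫`. -/
theorem pt_apply_d' (hd : d' ≠ d) (α β : ℤ) : (pt⟪α, β⟫) d' = 3 * b d' + β := by
  simp [hd]

/-- `pt` is injective in its two offsets. -/
theorem pt_inj (hd : d' ≠ d) {α β α' β' : ℤ} (h : pt⟪α, β⟫ = pt⟪α', β'⟫) : α = α' ∧ β = β' := by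
  have h1 := congr_fun h d
  have h2 := congr_fun h d'
  rw [pt_apply_d hd, pt_apply_d hd] at h1
  rw [pt_apply_d' hd, pt_apply_d' hd] at h2
  constructor <;> omega

/-- Two points of the frame are equal iff their offsets are. -/
theorem pt_eq_iff (hd : d' ≠ d) {α β α' β' : ℤ} : pt⟪α, β⟫ = pt⟪α', β'⟫ ↔ α = α' ∧ β = β' := by
  refine ⟨pt_inj hd, ?_⟩
  rintro ⟨rfl, rfl⟩
  rfl

/-- A point of the frame is determined by its two coordinates. -/
theorem eq_pt_of_apply (hd : d' ≠ d) {x : Site 2} {α β : ℤ} (h1 : x d = 3 * b d + α)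
    (h2 : x d' = 3 * b d' + β) : x = pt⟪α, β⟫ := by
  funext i
  rcases fin2_eq_or hd i with rfl | rfl
  · rw [pt_apply_d hd, h1]
  · rw [pt_apply_d' hd, h2]

/-- Unit step in direction `d`: `pt⟪α, β⟫ + e_d = pt⟪α + 1, β⟫`. -/
theorem pt_add_single_d (hd : d' ≠ d) (α β : ℤ) :
    pt⟪α, β⟫ + Pi.single d 1 = pt⟪α + 1, β⟫ := by
  refine eq_pt_of_apply hd ?_ ?_
  · rw [Pi.add_apply, pt_apply_d hd]; simp; ring
  · rw [Pi.add_apply, pt_apply_d' hd]; simp [hd]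

/-- Unit step in direction `d'`: `pt⟪α, β⟫ + e_{d'} = pt⟪α, β + 1⟫`. -/
theorem pt_add_single_d' (hd : d' ≠ d) (α β : ℤ) :
    pt⟪α, β⟫ + Pi.single d' 1 = pt⟪α, β + 1⟫ := by
  refine eq_pt_of_apply hd ?_ ?_
  · rw [Pi.add_apply, pt_apply_d hd]; simp [hd.symm]
  · rw [Pi.add_apply, pt_apply_d' hd]; simp; ring

/-- Membership of a frame point in a box, in frame coordinates (`d = 0`). -/
theorem pt_mem_box_iff_of_eq_zero (hd : d' ≠ d) (h0 : d = 0) (M N : ℕ) (α β : ℤ) :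
    pt⟪α, β⟫ ∈ KST2023.box M N ↔ |3 * b d + α| ≤ M ∧ |3 * b d' + β| ≤ N := by
  have h1 : d' = 1 := by rcases fin2_cases hd with ⟨-, h⟩ | ⟨h, -⟩ <;> [exact h; exact absurd h (h0 ▸ by decide)]
  subst h0; subst h1
  rw [KST2023.mem_box, pt_apply_d hd, pt_apply_d' hd]

/-- Membership of a frame point in a box, in frame coordinates (`d = 1`). -/
theorem pt_mem_box_iff_of_eq_one (hd : d' ≠ d) (h0 : d = 1) (M N : ℕ) (α β : ℤ) :
    pt⟪α, β⟫ ∈ KST2023.box M N ↔ |3 * b d' + β| ≤ M ∧ |3 * b d + α| ≤ N := by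
  have h1 : d' = 0 := by rcases fin2_cases hd with ⟨h, -⟩ | ⟨-, h⟩ <;> [exact absurd h (h0 ▸ by decide); exact h]
  subst h0; subst h1
  rw [KST2023.mem_box, pt_apply_d hd, pt_apply_d' hd]

/-! ### Axiality and coarse bases in the frame -/

/-- A label of direction `d` based at `pt⟪α, β⟫` is axial iff `3 ∣ β`. -/
theorem isAxialEdge_pt_d (hd : d' ≠ d) (α β : ℤ) : IsAxialEdge 3 (pt⟪α, β⟫, d) ↔ (3 : ℤ) ∣ β := by
  rw [isAxialEdge_iff]
  simp only [Nat.cast_ofNat]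
  rw [other_eq hd, pt_apply_d' hd]
  constructor
  · intro h
    have h3 : (3 : ℤ) ∣ 3 * b d' := dvd_mul_right 3 _
    exact (dvd_add_right h3).1 h
  · intro h
    exact dvd_add (dvd_mul_right 3 _) h

/-- A label of direction `d'` based at `pt⟪α, β⟫` is axial iff `3 ∣ α`. -/
theorem isAxialEdge_pt_d' (hd : d' ≠ d) (α β : ℤ) : IsAxialEdge 3 (pt⟪α, β⟫, d') ↔ (3 : ℤ) ∣ α := by
  rw [isAxialEdge_iff]
  simp only [Nat.cast_ofNat]
  rw [other_eq' hd, pt_apply_d hd]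
  constructor
  · intro h
    have h3 : (3 : ℤ) ∣ 3 * b d := dvd_mul_right 3 _
    exact (dvd_add_right h3).1 h
  · intro h
    exact dvd_add (dvd_mul_right 3 _) h

/-- The sub-edges `(pt⟪j, 0⟫, d)`, `0 ≤ j < 3`, have coarse base `b`. -/
theorem tupleBase_pt (hd : d' ≠ d) {j : ℤ} (h0 : 0 ≤ j) (h3 : j < 3) : tupleBase 3 (pt⟪j, 0⟫, d) = b := by
  funext i
  rw [tupleBase_apply]
  simp only [Nat.cast_ofNat]
  rcases fin2_eq_or hd i with rfl | rfl
  · rw [pt_apply_d hd]; omega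
  · rw [pt_apply_d' hd]; omega

/-- **An axial label of direction `d` with coarse base `b` is a sub-edge of the tuple**: its base
point is `pt⟪0, 0⟫`, `pt⟪1, 0⟫` or `pt⟪2, 0⟫`. -/
theorem eq_pt_of_axial (hd : d' ≠ d) {x : Site 2} (hax : IsAxialEdge 3 (x, d)) (htb : tupleBase 3 (x, d) = b) :
    x = pt⟪0, 0⟫ ∨ x = pt⟪1, 0⟫ ∨ x = pt⟪2, 0⟫ := by
  rw [isAxialEdge_iff] at hax
  simp only [Nat.cast_ofNat] at hax
  rw [other_eq hd] at hax
  have hb1 : x d / 3 = b d := by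
    have := congr_fun htb d; rwa [tupleBase_apply] at this
  have hb2 : x d' / 3 = b d' := by
    have := congr_fun htb d'; rwa [tupleBase_apply] at this
  obtain ⟨k, hk⟩ := hax
  have h2 : x d' = 3 * b d' + 0 := by omega
  have hr : x d = 3 * b d + 0 ∨ x d = 3 * b d + 1 ∨ x d = 3 * b d + 2 := by omega
  rcases hr with h1 | h1 | h1
  · exact Or.inl (eq_pt_of_apply hd h1 h2)
  · exact Or.inr (Or.inl (eq_pt_of_apply hd h1 h2))
  · exact Or.inr (Or.inr (eq_pt_of_apply hd h1 h2))

/-- A label whose direction is not `d` never has the tuple `(b, d)`. Together with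
`eq_pt_of_axial`: an axial label `e` with `(tupleBase 3 e, e.2) = (b, d)` is a sub-edge. -/
theorem mem_tuple_of_axial (hd : d' ≠ d) {e : Site 2 × Fin 2} (hax : IsAxialEdge 3 e)
    (htb : tupleBase 3 e = b) (he : e.2 = d) :
    e = (pt⟪0, 0⟫, d) ∨ e = (pt⟪1, 0⟫, d) ∨ e = (pt⟪2, 0⟫, d) := by
  obtain ⟨x, d₀⟩ := e
  simp only at he
  subst he
  rcases eq_pt_of_axial hd hax htb with h | h | h
  · exact Or.inl (by rw [h])
  · exact Or.inr (Or.inl (by rw [h]))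
  · exact Or.inr (Or.inr (by rw [h]))

/-- The sub-edges are axial. -/
theorem isAxialEdge_sub (hd : d' ≠ d) (j : ℤ) : IsAxialEdge 3 (pt⟪j, 0⟫, d) :=
  (isAxialEdge_pt_d hd j 0).2 (dvd_zero 3)

/-! ### The coins read by the opening rule -/

/-- **Locality of the opening rule.** Let `K₀` be a set of coins contained in the five coins of the
tuple `(b, d)` together with the own coins of a set `Λ` of labels, and let `S`, `S'` agree off
`K₀`.  Then every label which is neither a sub-edge of the tuple nor in `Λ` has the same state in
`S` and `S'`. -/
theorem refinementOpen_congr_off (hd : d' ≠ d) {S S' K₀ : Set (Site 2 × Fin 2 × Fin 3)}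
    {Λ : Set (Site 2 × Fin 2)}
    (hK : K₀ ⊆ {(b, d, (2 : Fin 3)), (b, d, (1 : Fin 3)), (pt⟪0, 0⟫, d, (0 : Fin 3)), (pt⟪1, 0⟫, d, (0 : Fin 3)),
      (pt⟪2, 0⟫, d, (0 : Fin 3))} ∪ (fun ℓ : Site 2 × Fin 2 => (ℓ.1, ℓ.2, (0 : Fin 3))) '' Λ)
    (hS : ∀ i, i ∉ K₀ → (i ∈ S ↔ i ∈ S')) {e : Site 2 × Fin 2}
    (he0 : e ≠ (pt⟪0, 0⟫, d)) (he1 : e ≠ (pt⟪1, 0⟫, d)) (he2 : e ≠ (pt⟪2, 0⟫, d)) (heΛ : e ∉ Λ) :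
    RefinementOpen 3 S e ↔ RefinementOpen 3 S' e := by
  -- the own coin of `e` is untouched
  have hown : (e.1, e.2, (0 : Fin 3)) ∉ K₀ := by
    intro h
    rcases hK h with h | ⟨ℓ, hℓ, hℓe⟩
    · simp only [Set.mem_insert_iff, Set.mem_singleton_iff, Prod.mk.injEq] at h
      rcases h with ⟨-, -, h⟩ | ⟨-, -, h⟩ | ⟨h1, h2, -⟩ | ⟨h1, h2, -⟩ | ⟨h1, h2, -⟩
      · exact absurd h (by decide)
      · exact absurd h (by decide)
      · exact he0 (Prod.ext h1 h2)
      · exact he1 (Prod.ext h1 h2)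
      · exact he2 (Prod.ext h1 h2)
    · simp only [Prod.mk.injEq] at hℓe
      exact heΛ (Prod.ext hℓe.1 hℓe.2.1 ▸ hℓ)
  by_cases hax : IsAxialEdge 3 e
  · -- the shared coin and the selector of the tuple of `e` are untouched
    have hnot : ∀ j : Fin 3, j ≠ 0 → (tupleBase 3 e, e.2, j) ∉ K₀ := by
      intro j hj h
      rcases hK h with h | ⟨ℓ, -, hℓe⟩
      · simp only [Set.mem_insert_iff, Set.mem_singleton_iff, Prod.mk.injEq] at h
        rcases h with ⟨h1, h2, -⟩ | ⟨h1, h2, -⟩ | ⟨-, -, h⟩ | ⟨-, -, h⟩ | ⟨-, -, h⟩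
        · rcases mem_tuple_of_axial hd hax h1 h2 with h | h | h
          · exact he0 h
          · exact he1 h
          · exact he2 h
        · rcases mem_tuple_of_axial hd hax h1 h2 with h | h | h
          · exact he0 h
          · exact he1 h
          · exact he2 h
        · exact hj h
        · exact hj h
        · exact hj h
      · simp only [Prod.mk.injEq] at hℓe
        exact hj hℓe.2.2.symm
    rw [refinementOpen_of_isAxialEdge S hax, refinementOpen_of_isAxialEdge S' hax,
      hS _ (hnot 2 (by decide)), hS _ (hnot 1 (by decide)), hS _ hown]
  · rw [refinementOpen_of_not_isAxialEdge S hax, refinementOpen_of_not_isAxialEdge S' hax, hS _ hown]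

/-- The opening rule of a non-axial label: its own coin. -/
theorem refinementOpen_iff_of_not_axial {S : Set (Site 2 × Fin 2 × Fin 3)} {e : Site 2 × Fin 2}
    (h : ¬ IsAxialEdge 3 e) : RefinementOpen 3 S e ↔ (e.1, e.2, (0 : Fin 3)) ∈ S :=
  refinementOpen_of_not_isAxialEdge S h

/-- The opening rule of the sub-edge `(pt⟪j, 0⟫, d)`: (selector on and shared coin on) or
(selector off and own coin on). -/
theorem refinementOpen_sub_iff (hd : d' ≠ d) (S : Set (Site 2 × Fin 2 × Fin 3)) {j : ℤ}
    (h0 : 0 ≤ j) (h3 : j < 3) :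
    RefinementOpen 3 S (pt⟪j, 0⟫, d) ↔
      ((b, d, (2 : Fin 3)) ∈ S ∧ (b, d, (1 : Fin 3)) ∈ S) ∨
        ((b, d, (2 : Fin 3)) ∉ S ∧ (pt⟪j, 0⟫, d, (0 : Fin 3)) ∈ S) := by
  rw [refinementOpen_of_isAxialEdge S (isAxialEdge_sub hd j), tupleBase_pt hd h0 h3]

end Cone3

/-- **Registered sub-goal `stub_cone3_model` of stub `stub_cone3`**: an axial label of direction
`d` whose coarse base is `b` is one of the three sub-edges `3b + j e_d`, `j = 0, 1, 2`, of the
tuple `(b, d)` of `M_3` (`Cone3.eq_pt_of_axial`) — the fact that makes the five coins of a tuple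
read by its sub-edges only. -/
theorem stub_cone3_model : ∀ (b : Site 2) (d d' : Fin 2), d' ≠ d → ∀ x : Site 2, IsAxialEdge 3 (x, d) → tupleBase 3 (x, d) = b → x = (3 : ℤ) • b + (0 : ℤ) • (Pi.single d (1 : ℤ) : Site 2) + (0 : ℤ) • (Pi.single d' (1 : ℤ) : Site 2) ∨ x = (3 : ℤ) • b + (1 : ℤ) • (Pi.single d (1 : ℤ) : Site 2) + (0 : ℤ) • (Pi.single d' (1 : ℤ) : Site 2) ∨ x = (3 : ℤ) • b + (2 : ℤ) • (Pi.single d (1 : ℤ) : Site 2) + (0 : ℤ) • (Pi.single d' (1 : ℤ) : Site 2) :=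
  fun _ _ _ hd _ hax htb => Cone3.eq_pt_of_axial hd hax htb

end Summit.CriticalPhenomena.CardyFormulaZ2.Cruxes.CriticalPathRSW.FiniteSizeEnvelope

end
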